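import Summits.KontsevichZagierPeriods.KontsevichZagierPeriods.Theorems.SoloInformedToricCornerMove
import HarnessLib

/-!
# Vertex moves `x_j ↦ 1 − x_j (j ∈ S)` inside the calculus

Solo programme `solo-KontsevichZagierPeriods-informed`, session s105 (closure properties, 6).

The corner move of `SoloInformedToricCornerMove` reflects ALL coordinates; here an arbitrary
subset `S` of the coordinates is reflected (`Φ_S(x)_j = 1 − x_j` for `j ∈ S`, `x_j` otherwise),
which moves the vertex `1_S` of the cube to the origin.  `Φ_S` is an involution of the open
cube, `ℚ`-semialgebraic, with constant derivative `diag(±1)`; since that derivative is an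
involution too, `|det Φ_S'| = 1` (Kontsevich–Zagier's rule (2)).

* `soloInformedVertexMove S`, `soloInformedVertexDeriv S`, `soloInformed_abs_det_vertexDeriv`;
* `soloInformedVertexReflect S = bind₁ (j ↦ 1 − Xⱼ if j ∈ S, Xⱼ otherwise)` with
  `aeval x (vertexReflect S P) = aeval (Φ_S x) P`;
* **THEOREM VERTEX** `soloInformed_presentable_of_vertexReflect_nondegenerate(_open)`:
  `[(0,1)ⁿ, P/Q]` and `[[0,1]ⁿ, P/Q]` are presentable (the cube crux
  `SoloInformedAyoubCubeResolutionCube` holds with `k = 1`) as soon as SOME vertex reflection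
  `vertexReflect S Q` is cube-nondegenerate — singularities concentrated at any one vertex of
  the cube.  `S = univ` is the corner move, `S = ∅` is THEOREM ND-GEN.
* Example: `Q = 1 − x₀ + x₀x₁` (vanishing at the vertex `(1,0)`); `vertexReflect {0} Q =
  x₀ + x₁ − x₀x₁` is the `ζ(2)` denominator, hence `[[0,1]², P/(1 − x₀ + x₀x₁)]` is presentable.

References: M. Kontsevich, D. Zagier, *Periods* (2001) §1.2 rule (2); J. Ayoub, EMS Newsl. 91
(2014) §2.2; A. G. Kouchnirenko, Invent. Math. 32 (1976) (Newton nondegeneracy).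
-/

noncomputable section

open scoped BigOperators
open MeasureTheory Set
open Literature.NumberTheory.Transcendental Literature.NumberTheory.Transcendental.KZ
open Literature.ModelTheory.ExponentialFields (IsSemialgebraic)

namespace Summit.KontsevichZagierPeriods.KontsevichZagierPeriods.Theorems

variable {n : ℕ}

/-! ## The vertex move -/

/-- The vertex move `Φ_S`: reflect the coordinates in `S`. -/
def soloInformedVertexMove (S : Finset (Fin n)) (x : Fin n → ℝ) : Fin n → ℝ :=
  fun j => if j ∈ S then 1 - x j else x j

/-- The vertex move is an involution. -/
theorem soloInformed_vertexMove_vertexMove (S : Finset (Fin n)) (x : Fin n → ℝ) :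
    soloInformedVertexMove S (soloInformedVertexMove S x) = x := by
  funext j
  by_cases hj : j ∈ S <;> simp [soloInformedVertexMove, hj]

/-- The vertex move is injective. -/
theorem soloInformed_vertexMove_injective (S : Finset (Fin n)) :
    Function.Injective (soloInformedVertexMove S) := fun x y h => by
  rw [← soloInformed_vertexMove_vertexMove S x, h, soloInformed_vertexMove_vertexMove S y]

/-- The vertex move preserves the open cube. -/
theorem soloInformed_vertexMove_mem (S : Finset (Fin n)) {x : Fin n → ℝ}
    (hx : x ∈ soloInformedOpenCube n) : soloInformedVertexMove S x ∈ soloInformedOpenCube n :=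
  fun j => by
    have h1 := (hx j).1
    have h2 := (hx j).2
    by_cases hj : j ∈ S
    · simp only [soloInformedVertexMove, hj, if_true]
      exact ⟨by linarith, by linarith⟩
    · simp only [soloInformedVertexMove, hj, if_false]
      exact ⟨h1, h2⟩

/-- The vertex move maps the open cube onto itself. -/
theorem soloInformed_image_vertexMove (S : Finset (Fin n)) :
    soloInformedVertexMove S '' soloInformedOpenCube n = soloInformedOpenCube n :=
  Subset.antisymm (image_subset_iff.2 fun _ hx => soloInformed_vertexMove_mem S hx) fun x hx =>
    ⟨soloInformedVertexMove S x, soloInformed_vertexMove_mem S hx,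
      soloInformed_vertexMove_vertexMove S x⟩

/-- The (constant) derivative `diag(±1)` of the vertex move. -/
def soloInformedVertexDeriv (S : Finset (Fin n)) : (Fin n → ℝ) →L[ℝ] (Fin n → ℝ) :=
  ContinuousLinearMap.pi fun j =>
    if j ∈ S then -ContinuousLinearMap.proj (R := ℝ) (φ := fun _ : Fin n => ℝ) j
    else ContinuousLinearMap.proj (R := ℝ) (φ := fun _ : Fin n => ℝ) j

/-- Components of the derivative of the vertex move. -/
theorem soloInformed_vertexDeriv_apply (S : Finset (Fin n)) (v : Fin n → ℝ) (j : Fin n) :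
    soloInformedVertexDeriv S v j = if j ∈ S then -v j else v j := by
  unfold soloInformedVertexDeriv
  rw [ContinuousLinearMap.pi_apply]
  by_cases hj : j ∈ S <;> simp [hj]

/-- The derivative of the vertex move is an involution. -/
theorem soloInformed_vertexDeriv_vertexDeriv (S : Finset (Fin n)) (v : Fin n → ℝ) :
    soloInformedVertexDeriv S (soloInformedVertexDeriv S v) = v := by
  funext j
  rw [soloInformed_vertexDeriv_apply, soloInformed_vertexDeriv_apply]
  by_cases hj : j ∈ S <;> simp [hj]

/-- `|det diag(±1)| = 1`: the derivative of the vertex move is an involution, so its determinant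
squares to `1`. -/
theorem soloInformed_abs_det_vertexDeriv (S : Finset (Fin n)) :
    |(soloInformedVertexDeriv S).det| = 1 := by
  have hcomp : ((soloInformedVertexDeriv S : (Fin n → ℝ) →L[ℝ] (Fin n → ℝ)) :
      (Fin n → ℝ) →ₗ[ℝ] (Fin n → ℝ)).comp
        ((soloInformedVertexDeriv S : (Fin n → ℝ) →L[ℝ] (Fin n → ℝ)) :
          (Fin n → ℝ) →ₗ[ℝ] (Fin n → ℝ)) = LinearMap.id :=
    LinearMap.ext fun v => by
      simp only [LinearMap.comp_apply, ContinuousLinearMap.coe_coe, LinearMap.id_apply]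
      exact soloInformed_vertexDeriv_vertexDeriv S v
  have hsq : (soloInformedVertexDeriv S).det * (soloInformedVertexDeriv S).det = 1 := by
    change LinearMap.det _ * LinearMap.det _ = 1
    rw [← LinearMap.det_comp, hcomp, LinearMap.det_id]
  rcases mul_self_eq_one_iff.1 hsq with h | h <;> simp [h]

/-- The vertex move has derivative `diag(±1)` everywhere. -/
theorem soloInformed_hasFDerivAt_vertexMove (S : Finset (Fin n)) (x : Fin n → ℝ) :
    HasFDerivAt (soloInformedVertexMove S) (soloInformedVertexDeriv S) x := by
  unfold soloInformedVertexMove soloInformedVertexDeriv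
  refine hasFDerivAt_pi.2 fun j => ?_
  by_cases hj : j ∈ S
  · simp only [hj, if_true]
    exact (hasFDerivAt_apply j x).const_sub 1
  · simp only [hj, if_false]
    exact hasFDerivAt_apply j x

/-- The vertex move is a `ℚ`-semialgebraic map on every `ℚ`-semialgebraic set. -/
theorem soloInformed_isSemialgebraicMapOn_vertexMove (S : Finset (Fin n))
    {s : Set (Fin n → ℝ)} (hs : IsSemialgebraic ℚ s) :
    IsSemialgebraicMapOn ℚ s (soloInformedVertexMove S) :=
  (isSemialgebraicMapOn_aeval hs fun j =>
      (if j ∈ S then 1 - MvPolynomial.X j else MvPolynomial.X j :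
        MvPolynomial (Fin n) ℚ)).congr
    fun x _ => by
      funext j
      by_cases hj : j ∈ S <;> simp [soloInformedVertexMove, hj]

/-! ## Vertex-reflected polynomials -/

/-- The vertex reflection `P ↦ P(Φ_S x)` of `ℚ[x₁, …, xₙ]` (an algebra endomorphism). -/
def soloInformedVertexReflect (S : Finset (Fin n)) :
    MvPolynomial (Fin n) ℚ →ₐ[ℚ] MvPolynomial (Fin n) ℚ :=
  MvPolynomial.bind₁ fun j => if j ∈ S then 1 - MvPolynomial.X j else MvPolynomial.X j

/-- Vertex reflection of a variable. -/
theorem soloInformed_vertexReflect_X (S : Finset (Fin n)) (j : Fin n) :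
    soloInformedVertexReflect S (MvPolynomial.X j) =
      if j ∈ S then 1 - MvPolynomial.X j else MvPolynomial.X j := by
  unfold soloInformedVertexReflect
  rw [MvPolynomial.bind₁_X_right]

/-- `S = univ`: the vertex reflection is the corner reflection. -/
theorem soloInformed_vertexReflect_univ :
    soloInformedVertexReflect (Finset.univ : Finset (Fin n)) = soloInformedReflect n := by
  refine MvPolynomial.algHom_ext fun j => ?_
  rw [soloInformed_vertexReflect_X, soloInformed_reflect_X, if_pos (Finset.mem_univ j)]

/-- `S = ∅`: the vertex reflection is the identity. -/
theorem soloInformed_vertexReflect_empty :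
    soloInformedVertexReflect (∅ : Finset (Fin n)) = AlgHom.id ℚ (MvPolynomial (Fin n) ℚ) := by
  refine MvPolynomial.algHom_ext fun j => ?_
  rw [soloInformed_vertexReflect_X, if_neg (by simp), AlgHom.id_apply]

/-- Evaluating the vertex-reflected polynomial is evaluating at the vertex-moved point. -/
theorem soloInformed_aeval_vertexReflect (S : Finset (Fin n)) (x : Fin n → ℝ)
    (P : MvPolynomial (Fin n) ℚ) :
    MvPolynomial.aeval x (soloInformedVertexReflect S P) =
      MvPolynomial.aeval (soloInformedVertexMove S x) P := by
  unfold soloInformedVertexReflect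
  rw [MvPolynomial.aeval_bind₁]
  have h : (fun i => MvPolynomial.aeval x
      (if i ∈ S then 1 - MvPolynomial.X i else MvPolynomial.X i : MvPolynomial (Fin n) ℚ)) =
      soloInformedVertexMove S x := by
    funext j
    by_cases hj : j ∈ S <;> simp [soloInformedVertexMove, hj]
  rw [h]

/-! ## Presentability through a vertex move -/

/-- **THEOREM VERTEX (open cube).**  If some vertex reflection `vertexReflect S Q` of the
denominator is cube-nondegenerate, then every `IntegralRep` with domain `(0,1)ⁿ` and integrand
`P/Q` is presentable: rule (2) along `Φ_S` (`|det| = 1`) turns it into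
`[(0,1)ⁿ, vertexReflect S P / vertexReflect S Q]`, presentable by THEOREM ND-GEN on the open
cube. [this work] -/
theorem soloInformed_presentable_of_vertexReflect_nondegenerate_open (S : Finset (Fin n))
    (P Q : MvPolynomial (Fin n) ℚ)
    (hND : SoloInformedCubeNondegenerate (soloInformedVertexReflect S Q)) (ρ : IntegralRep n)
    (hρ : ρ.domain = soloInformedOpenCube n)
    (hρi : EqOn ρ.integrand (fun x => MvPolynomial.aeval x P / MvPolynomial.aeval x Q)
      (soloInformedOpenCube n)) :
    of ρ ∈ soloInformedPresentable := by
  have hQt : ∀ x ∈ soloInformedOpenCube n,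
      MvPolynomial.aeval x (soloInformedVertexReflect S Q) ≠ 0 := fun x hx =>
    soloInformed_aeval_ne_zero_of_nondegenerate hND fun i => ⟨(hx i).1, (hx i).2.le⟩
  have hint : IntegrableOn (fun x => MvPolynomial.aeval x P / MvPolynomial.aeval x Q)
      (soloInformedOpenCube n) := by
    have h := ρ.integrableOn.congr_fun (fun x hx => hρi (by rwa [hρ] at hx))
      ρ.measurableSet_domain_holds
    rwa [hρ] at h
  have hint' : IntegrableOn (fun x => MvPolynomial.aeval x (soloInformedVertexReflect S P) /
      MvPolynomial.aeval x (soloInformedVertexReflect S Q)) (soloInformedOpenCube n) := by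
    have hmeas : MeasurableSet (soloInformedOpenCube n) := hρ ▸ ρ.measurableSet_domain_holds
    have h := (integrableOn_image_iff_integrableOn_abs_det_fderiv_smul volume hmeas
      (fun x _ => (soloInformed_hasFDerivAt_vertexMove S x).hasFDerivWithinAt)
      (soloInformed_vertexMove_injective S).injOn
      (fun x => MvPolynomial.aeval x P / MvPolynomial.aeval x Q)).1
      (by rw [soloInformed_image_vertexMove]; exact hint)
    refine h.congr_fun (fun x _ => ?_) hmeas
    simp only [soloInformed_abs_det_vertexDeriv, one_smul, soloInformed_aeval_vertexReflect]
  -- rule (2) along the vertex move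
  set ρt := IntegralRep.ofRational (soloInformedOpenCube n) (soloInformedVertexReflect S P)
      (soloInformedVertexReflect S Q) (isSemialgebraic_soloInformedOpenCube n) hQt hint'
    with hρt
  have h2 : of ρt - of ρ ∈ relations := by
    refine changeOfVariablesRel_subset_relations ⟨n, ρt, ρ, soloInformedVertexMove S,
      fun _ => soloInformedVertexDeriv S,
      soloInformed_isSemialgebraicMapOn_vertexMove S (isSemialgebraic_soloInformedOpenCube n),
      fun x _ => (soloInformed_hasFDerivAt_vertexMove S x).hasFDerivWithinAt,
      (soloInformed_vertexMove_injective S).injOn, ?_, fun x hx => ?_, rfl⟩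
    · show ρ.domain = soloInformedVertexMove S '' soloInformedOpenCube n
      rw [soloInformed_image_vertexMove, hρ]
    · have hx' : x ∈ soloInformedOpenCube n := hx
      show MvPolynomial.aeval x (soloInformedVertexReflect S P) /
          MvPolynomial.aeval x (soloInformedVertexReflect S Q) = _
      rw [hρi (soloInformed_vertexMove_mem S hx'), soloInformed_abs_det_vertexDeriv, mul_one,
        soloInformed_aeval_vertexReflect, soloInformed_aeval_vertexReflect]
  have hpres := soloInformed_presentable_of_nondegenerate_rational_open
    (soloInformedVertexReflect S P) (soloInformedVertexReflect S Q) hND ρt rfl fun x _ => rfl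
  rw [← neg_sub] at h2
  exact soloInformed_presentable_of_sub_mem (by simpa using relations.neg_mem h2) hpres

/-- **THEOREM VERTEX (closed cube).**  `[[0,1]ⁿ, P/Q]` is presentable as soon as some vertex
reflection `vertexReflect S Q` is cube-nondegenerate. [this work] -/
theorem soloInformed_presentable_of_vertexReflect_nondegenerate (S : Finset (Fin n))
    (P Q : MvPolynomial (Fin n) ℚ)
    (hND : SoloInformedCubeNondegenerate (soloInformedVertexReflect S Q)) (r : IntegralRep n)
    (hr : r.domain = soloInformedCube n)
    (hri : EqOn r.integrand (fun x => MvPolynomial.aeval x P / MvPolynomial.aeval x Q)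
      (soloInformedOpenCube n)) :
    of r ∈ soloInformedPresentable := by
  have hOsub : soloInformedOpenCube n ⊆ r.domain := hr ▸ soloInformedOpenCube_subset_cube n
  set r₀ := r.restrict (soloInformedOpenCube n) (isSemialgebraic_soloInformedOpenCube n) hOsub
    with hr₀
  have h₀ : of r - of r₀ ∈ relations :=
    r.of_sub_of_restrict_mem_relations (isSemialgebraic_soloInformedOpenCube n) hOsub
      (by rw [hr]; exact soloInformed_volume_cube_diff_openCube n)
  exact soloInformed_presentable_of_sub_mem h₀
    (soloInformed_presentable_of_vertexReflect_nondegenerate_open S P Q hND r₀ rfl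
      fun x hx => hri hx)

/-- THEOREM VERTEX in the output format of the cube crux `SoloInformedAyoubCubeResolutionCube`
(`k = 1`). [this work] -/
theorem soloInformed_cubeResolution_vertexReflect_nondegenerate (S : Finset (Fin n))
    (P Q : MvPolynomial (Fin n) ℚ)
    (hND : SoloInformedCubeNondegenerate (soloInformedVertexReflect S Q)) (r : IntegralRep n)
    (hr : r.domain = soloInformedCube n)
    (hri : EqOn r.integrand (fun x => MvPolynomial.aeval x P / MvPolynomial.aeval x Q)
      (soloInformedOpenCube n)) :
    ∃ (k : ℕ) (_ : k ≠ 0) (m' : ℕ) (d : Fin m' → ℕ) (G : ∀ j, SoloInformedCubeGerm (d j))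
      (c : Fin m' → ℤ) (ρ : ∀ j, IntegralRep (d j)),
      (∀ j, (ρ j).domain = soloInformedCube (d j)) ∧
      (∀ j, EqOn (ρ j).integrand (fun x => ((G j).g (soloInformedToC (d j) x)).re)
        (soloInformedCube (d j))) ∧
      k • of r - ∑ j, c j • of (ρ j) ∈ relations :=
  soloInformed_exists_fin_of_presentable
    (soloInformed_presentable_of_vertexReflect_nondegenerate S P Q hND r hr hri)

/-! ## Example: a denominator vanishing at the vertex `(1, 0)` -/

/-- `vertexReflect {0} (1 − x₀ + x₀x₁) = x₀ + x₁ − x₀x₁`, the `ζ(2)` denominator. -/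
theorem soloInformed_vertexReflect_oneSubXAddXY :
    soloInformedVertexReflect ({0} : Finset (Fin 2))
        (1 - MvPolynomial.X 0 + MvPolynomial.X 0 * MvPolynomial.X 1) =
      MvPolynomial.X 0 + MvPolynomial.X 1 - MvPolynomial.X 0 * MvPolynomial.X 1 := by
  simp only [map_add, map_sub, map_one, map_mul, soloInformed_vertexReflect_X,
    Finset.mem_singleton, if_true, show ((1 : Fin 2) = 0) = False from by simp, if_false]
  ring

/-- Example: `Q = 1 − x₀ + x₀x₁ = (1 − x₀) + x₀x₁` vanishes on the closed square exactly at the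
vertex `(1, 0)`, where no initial-form condition at the origin sees it; after the vertex move
`x₀ ↦ 1 − x₀` it is the `ζ(2)` denominator, so `[[0,1]², P/(1 − x₀ + x₀x₁)]` is presentable for
every numerator `P ∈ ℚ[x₀, x₁]`. [this work] -/
theorem soloInformed_presentable_oneSubXAddXY (P : MvPolynomial (Fin 2) ℚ) (r : IntegralRep 2)
    (hr : r.domain = soloInformedCube 2)
    (hri : EqOn r.integrand (fun x => MvPolynomial.aeval x P / MvPolynomial.aeval x
      (1 - MvPolynomial.X 0 + MvPolynomial.X 0 * MvPolynomial.X 1 : MvPolynomial (Fin 2) ℚ))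
      (soloInformedOpenCube 2)) :
    of r ∈ soloInformedPresentable :=
  soloInformed_presentable_of_vertexReflect_nondegenerate {0} P _
    (by rw [soloInformed_vertexReflect_oneSubXAddXY]
        exact soloInformed_cubeNondegenerate_zeta2Denominator) r hr hri

end Summit.KontsevichZagierPeriods.KontsevichZagierPeriods.Theorems
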